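import Mathlib.Analysis.SpecificLimits.Basic
import Summits.CriticalPhenomena.PercolationContinuityZ3.Theorems.Transplant.SamePParamMono
import HarnessLib

/-!
# (S4) The Step-II / Step-III COUNT BOOKKEEPING of design (D), uniformly on `[p/2, p]`: the number of seeds `k` (chosen at the LEFT endpoint
# `p/2`), the number of contacts `N = k · B` and the number of levels `L` (chosen at the RIGHT endpoint `p`) such that at EVERY running
# parameter `q ∈ [p/2, p]`: `(1 - q^s)^k ≤ δ` and `1/(1-q)^{Δ'·N} ≤ δ · L'` for all `L' ≥ L`

builds on p205010 (kernel theorem, internal audit signed; external expert review pending) — nothing in this file uses p205010.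
Lane `prim-bschramm-*`, seat `prim-bschramm-stmt` (gen 5; owner split 15:02:43Z item (S)); helper file (`--supports stmt-CriticalPhenomena-4575`).

These are the two parameter-DEPENDENT hypotheses of the kit clauses (`hk`, `hcount` of `kitClauseQ` / `hkits_tube` / `kitsAt_tstep` /
`kitsAt_stepE`; `TargetPropertyUP` body lines `(1 - p^{s_B})^k ≤ δ` and `1/(1-p)^{ΔN} ≤ δ·#levels`) — all other constants are p-free (U2).
Refuter p5-g3 (14:35Z, D13): `(1 - q^s)^k` DEcreases in `q`, so `k` must be fixed at `q = p/2`; `1/(1-q)^m` INcreases in `q`, so the level count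
is fixed at `q = p` (`SamePParam.stepIII_bound_of_half_le`, `SamePParam.stepII_bound_of_le`, p221054).
* **`BoxProdZ2.exists_kit_counts`** — `0 < δ`, `0 < p < 1` ⟹ `∃ k N L, N = k * B ∧ 0 < L ∧ ∀ q ∈ [p/2, p], (1 - q^s)^k ≤ δ ∧ ∀ L' ≥ L,
  1/(1-q)^{Δ'·N} ≤ δ·L'` (with `s := kitSB Δ M ψ`, `B := kitB Δ M ψ` this is the instance's `hk`/`hN`/`hcount` at every running `q`, for any
  window with at least `L` levels).
[cite: KozmaNitzan2024, §4 Lemma 10 Steps II–III (pp. 18–19)]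
-/

noncomputable section

namespace Summit.CriticalPhenomena.PercolationContinuityZ3.Theorems

namespace Transplant

namespace BoxProdZ2

open SamePParam

/-- **Seeds at the left endpoint, levels at the right endpoint**: for `δ > 0` and `0 < p < 1` there are `k`, `N = k · B` and `L > 0` such that
for every `q ∈ [p/2, p]`: `(1 - q^s)^k ≤ δ` and `1/(1-q)^{Δ'·N} ≤ δ · L'` for every `L' ≥ L`.
[cite: KozmaNitzan2024, §4 Lemma 10 Steps II–III (pp. 18–19)] -/
theorem exists_kit_counts (Δ' s B : ℕ) {δ : ℝ} (hδ : 0 < δ) (p : unitInterval) (hp0 : 0 < (p : ℝ)) (hp1 : (p : ℝ) < 1) :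
    ∃ k N L : ℕ, N = k * B ∧ 0 < L ∧ ∀ q : unitInterval, (p : ℝ) / 2 ≤ q → (q : ℝ) ≤ p →
      (1 - (q : ℝ) ^ s) ^ k ≤ δ ∧ ∀ L' : ℕ, L ≤ L' → 1 / (1 - (q : ℝ)) ^ (Δ' * N) ≤ δ * (L' : ℝ) := by
  -- Step III at the left endpoint `p/2`
  have hx0 : 0 < ((p : ℝ) / 2) ^ s := by positivity
  have hx1 : ((p : ℝ) / 2) ^ s ≤ 1 := pow_le_one₀ (by positivity) (by linarith [p.2.2])
  obtain ⟨k, hk⟩ := exists_pow_lt_of_lt_one hδ (show 1 - ((p : ℝ) / 2) ^ s < 1 by linarith)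
  -- Step II at the right endpoint `p`
  set N : ℕ := k * B with hN
  set A : ℝ := 1 / (1 - (p : ℝ)) ^ (Δ' * N) with hA
  set L : ℕ := ⌈A / δ⌉₊ + 1 with hL
  have hAL : A ≤ δ * (L : ℝ) := by
    have h1 : A / δ ≤ (⌈A / δ⌉₊ : ℝ) := Nat.le_ceil _
    have h2 : (L : ℝ) = (⌈A / δ⌉₊ : ℝ) + 1 := by simp [hL]
    have h3 : A = δ * (A / δ) := by field_simp
    calc A = δ * (A / δ) := h3
      _ ≤ δ * ((⌈A / δ⌉₊ : ℝ) + 1) := mul_le_mul_of_nonneg_left (by linarith) hδ.le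
      _ = δ * (L : ℝ) := by rw [h2]
  refine ⟨k, N, L, rfl, by simp [hL], fun q hq1 hq2 => ⟨stepIII_bound_of_half_le p q hq1 hk.le, fun L' hL' => ?_⟩⟩
  have hmono : δ * (L : ℝ) ≤ δ * (L' : ℝ) := by
    have : (L : ℝ) ≤ (L' : ℝ) := by exact_mod_cast hL'
    nlinarith
  exact stepII_bound_of_le hq2 hp1 (hAL.trans hmono)

end BoxProdZ2

end Transplant

end Summit.CriticalPhenomena.PercolationContinuityZ3.Theorems

end
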